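import Mathlib.Dynamics.Ergodic.Ergodic
import Mathlib.Dynamics.BirkhoffSum.Average
import Mathlib.MeasureTheory.Function.ConvergenceInMeasure
import Literature.Dynamics.Ergodic.BirkhoffErgodicTheoremProofs
import HarnessLib

/-!
# Stub `stub_windowDefectLever` of the line `Sketch` (idea `ergodic-window-is-von-neumann`)
# for the crux `InformationPercolationEngine.PercolationClosesChaos` (stmt-AtomisticToContinuum-15178)

Sorry-free discharge of the registered stub `stub_windowDefectLever` of the lead's skeleton
(`work/PercolationClosesChaos.lean`, §3): the card's abstract LEVER.

**Statement.** For an ergodic probability-preserving map `T` of `(Ω, μ)` and four integrable observables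
`F₀, …, F₃ : Ω → ℝ` whose means satisfy the cross-ratio identity
`(∫ F₀)(∫ F₁) - (∫ F₂)(∫ F₃) = 0`, the cross-ratio defect of the `M`-step Birkhoff averages
`X_M = A_M F₀ · A_M F₁ - A_M F₂ · A_M F₃` tends to `0` in measure: `μ {η ≤ |X_M|} → 0` as `M → ∞` for every
`η > 0`.

**Proof.** Birkhoff's pointwise ergodic theorem, ergodic case (tree:
`Literature.Dynamics.Ergodic.birkhoff_ergodic_theorem_of_ergodic_holds`, Dajani–Kalle Thm 3.1.1), applied to each
`F_j`, gives `A_M F_j → ∫ F_j` a.e.; by continuity of `(a, b, c, d) ↦ a b - c d` the defect `X_M` tends a.e. to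
`(∫ F₀)(∫ F₁) - (∫ F₂)(∫ F₃) = 0`. Each `X_M` is a.e. strongly measurable (Birkhoff sums of integrable
observables along a measure preserving map are integrable, tree `Literature.Dynamics.Ergodic.integrable_birkhoffSum`),
so a.e. convergence implies convergence in measure on the probability space
(Mathlib `MeasureTheory.tendstoInMeasure_of_tendsto_ae`), which at level `η` is the claim (`dist x 0 = |x|`).
-/

noncomputable section

open MeasureTheory Set Filter Topology

namespace Summit.AtomisticToContinuum.HydrodynamicLimit.Theorems.ErgodicWindowLine

/-- Birkhoff averages of an integrable observable along a measure preserving map are a.e. strongly measurable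
(from the tree's `Literature.Dynamics.Ergodic.integrable_birkhoffSum`: `A_n g = n⁻¹ · S_n g`). -/
theorem aestronglyMeasurable_birkhoffAverage_of_measurePreserving {Ω : Type*} [MeasurableSpace Ω]
    {μ : Measure Ω} {T : Ω → Ω} (hT : MeasurePreserving T μ μ) {g : Ω → ℝ} (hg : Integrable g μ) (n : ℕ) :
    AEStronglyMeasurable (birkhoffAverage ℝ T g n) μ := by
  have h : AEStronglyMeasurable (fun x => (n : ℝ)⁻¹ * birkhoffSum T g n x) μ :=
    (Literature.Dynamics.Ergodic.integrable_birkhoffSum hT hg n).aestronglyMeasurable.const_mul _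
  refine h.congr (Eventually.of_forall fun x => ?_)
  simp only [birkhoffAverage, smul_eq_mul]

/-- The card's §3 LEVER in abstract form: for an ergodic probability-preserving map `T` and four integrable
observables whose means satisfy the cross-ratio identity `(∫ F₀)(∫ F₁) - (∫ F₂)(∫ F₃) = 0`, the cross-ratio of
the `M`-step Birkhoff averages tends to `0` in measure as `M → ∞` (Birkhoff's pointwise ergodic theorem
coordinatewise — tree `Literature.Dynamics.Ergodic.birkhoff_ergodic_theorem_of_ergodic_holds` — continuity of
`(a, b, c, d) ↦ a b - c d`, and a.e. convergence ⇒ convergence in measure on a probability space). -/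
theorem stub_windowDefectLever {Ω : Type*} [MeasurableSpace Ω] {μ : Measure Ω} [IsProbabilityMeasure μ]
    {T : Ω → Ω} (hT : Ergodic T μ) (F : Fin 4 → Ω → ℝ) (hF : ∀ j, Integrable (F j) μ)
    (h0 : (∫ ω, F 0 ω ∂μ) * (∫ ω, F 1 ω ∂μ) - (∫ ω, F 2 ω ∂μ) * (∫ ω, F 3 ω ∂μ) = 0)
    (η : ℝ) (hη : 0 < η) :
    Tendsto (fun M : ℕ => μ {ω | η ≤ |birkhoffAverage ℝ T (F 0) M ω * birkhoffAverage ℝ T (F 1) M ω -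
      birkhoffAverage ℝ T (F 2) M ω * birkhoffAverage ℝ T (F 3) M ω|}) atTop (𝓝 0) := by
  -- Birkhoff's pointwise ergodic theorem (ergodic case) for each of the four observables
  have hB : ∀ j : Fin 4, ∀ᵐ ω ∂μ,
      Tendsto (fun n : ℕ => birkhoffAverage ℝ T (F j) n ω) atTop (𝓝 (∫ ω, F j ω ∂μ)) := fun j =>
    Literature.Dynamics.Ergodic.birkhoff_ergodic_theorem_of_ergodic_holds μ T hT (F j) (hF j)
  -- hence the cross-ratio defect of the averages tends a.e. to the defect of the means, which is `0`
  have hae : ∀ᵐ ω ∂μ, Tendsto (fun M : ℕ => birkhoffAverage ℝ T (F 0) M ω * birkhoffAverage ℝ T (F 1) M ω -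
      birkhoffAverage ℝ T (F 2) M ω * birkhoffAverage ℝ T (F 3) M ω) atTop
      (𝓝 ((fun _ : Ω => (0 : ℝ)) ω)) := by
    filter_upwards [hB 0, hB 1, hB 2, hB 3] with ω hω0 hω1 hω2 hω3
    have h := (hω0.mul hω1).sub (hω2.mul hω3)
    rw [h0] at h
    exact h
  -- each defect is a.e. strongly measurable (its four factors are)
  have hA : ∀ (j : Fin 4) (M : ℕ), AEStronglyMeasurable (birkhoffAverage ℝ T (F j) M) μ := fun j M =>
    aestronglyMeasurable_birkhoffAverage_of_measurePreserving hT.toMeasurePreserving (hF j) M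
  have hmeas : ∀ M : ℕ, AEStronglyMeasurable (fun ω => birkhoffAverage ℝ T (F 0) M ω *
      birkhoffAverage ℝ T (F 1) M ω - birkhoffAverage ℝ T (F 2) M ω * birkhoffAverage ℝ T (F 3) M ω) μ :=
    fun M => ((hA 0 M).mul (hA 1 M)).sub ((hA 2 M).mul (hA 3 M))
  -- a.e. convergence implies convergence in measure on a finite measure space; read it off at level `η`
  have hIM := tendstoInMeasure_of_tendsto_ae hmeas hae
  have h := (tendstoInMeasure_iff_dist.mp hIM) η hη
  simpa only [Real.dist_eq, sub_zero] using h

end Summit.AtomisticToContinuum.HydrodynamicLimit.Theorems.ErgodicWindowLine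

end
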